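/-
Copyright (c) 2026. All rights reserved.
Released under Apache 2.0 license as described in the file LICENSE.
-/
import Literature.MathematicalPhysics.QuantumLattice.HartreeFockSDWTorus
import HarnessLib

/-!
# Free-fermion (paramagnetic Hartree–Fock) upper bounds on the torus at arbitrary filling

Topic `MathematicalPhysics/QuantumLattice`, family `hubbard`; continuation of
`HartreeFockUpperBound.lean` (`HartreeFock.groundEnergyAt_le_hfEnergy`, Bach–Lieb–Solovej 1994
(2c.36)) and `HartreeFockSDWTorus.lean` (`conjDiag f = W diag(f) Wᴴ`, the algebra of functions of
the torus hopping matrix, and the spin-block lift `spinBlock`).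

For the Hubbard model `H(t,U) = T + U Σ_x n_{x↑} n_{x↓}` on the discrete torus `(ℤ/Lℤ)^d`, `L ≥ 3`,
and ANY two sets of momenta `S↑, S↓ ⊆ (ℤ/Lℤ)^d`, the Slater determinant filling the plane waves
`k ∈ S_σ` with spin `σ` (one-particle density matrix `P_σ = W 1_{S_σ} Wᴴ`, a projection of rank
`|S_σ|` with CONSTANT density `P_σ(x,x) = |S_σ|/L^d` by translation invariance) has Hartree–Fock
energy `Σ_{k∈S↑} ε_k + Σ_{k∈S↓} ε_k + U |S↑| |S↓| / L^d`, `ε_k = -2t Σᵢ cos(2πkᵢ/L)` (the exchange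
term vanishes for collinear states, `HartreeFock.hfEnergy_spinBlock`). Hence

* **`hubbardTorus_groundEnergyAt_le_freeFermion`**:
  `E_L(|S↑| + |S↓|) ≤ Σ_{k∈S↑} ε_k + Σ_{k∈S↓} ε_k + U |S↑| |S↓| / L^d` for all real `t, U`, all
  `L ≥ 3`, all `d`, and all `S↑, S↓` — the elementary "free Fermi sea + U n↑ n↓" upper bound at
  every filling (no parity or closed-shell hypothesis: an open shell is just a choice of `S_σ`);
* `hubbardTorus_groundEnergyAt_le_freeFermion_momentum`: the same with `S_σ ⊆ (ℤ/Lℤ)^d` given as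
  `Finset (TorusSite d L)` and `ε_k` written out.

This is the paramagnetic (`Δ = 0`) companion of the antiferromagnetic bound
`hubbardTorus_groundEnergyAt_le_sdw` and the textbook first-order-perturbation / Hartree–Fock
estimate (e.g. Lieb–Wu 1968 discussion; Bach–Lieb–Solovej 1994 §2c: `E^{HF} ≤` energy of any
Slater determinant). Everything is proved; definitions have bodies; no named facts.

## Mathlib / tree search

Tree (REUSED): `HartreeFock.conjDiag` + `conjDiag_mul`, `conjTranspose_conjDiag`, `trace_conjDiag`,
`conjDiag_apply_self`, `hopMatrix_eq_conjDiag`; `HartreeFock.spinBlock` + `conjTranspose_spinBlock`,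
`spinBlock_mul_spinBlock`, `trace_spinBlock`, `hfEnergy_spinBlock`;
`HartreeFock.groundEnergyAt_le_hfEnergy`; `LangerMattis.siteBand`, `FermionTorus.equivTorusSite`.
Mathlib: `Finset.sum_ite_mem`, `Finset.sum_map`, `Finset.card_map`.
`lean search 'freeFermion|planeWaveProj|Fermi sea'`: no such bound in Mathlib or the tree.

## References

* V. Bach, E. H. Lieb, J. P. Solovej, J. Stat. Phys. 76 (1994) 3, §2c, eq. (2c.36) (the
  Hartree–Fock energy is a variational upper bound; plane-wave Slater determinants).
  [BachLiebSolovej1994]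
* E. H. Lieb, F. Y. Wu, Phys. Rev. Lett. 20 (1968) 1445 (the `U`-linear upper estimate
  `E ≤ E_free + U N↑N↓/|Λ|`). [folklore]
-/

noncomputable section

namespace Literature.MathematicalPhysics.QuantumLattice

namespace HartreeFock

open Matrix Finset Literature.Probability.LatticeModels
  Literature.MathematicalPhysics.QuantumLattice.LangerMattis
open scoped ComplexConjugate ComplexOrder

variable {d L : ℕ} [NeZero L]

/-! ### Plane-wave projections -/

variable (d L) in
/-- The one-particle density matrix of the plane waves `k ∈ S`: `P_S = W 1_S Wᴴ`, the orthogonal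
projection onto `span {w_k : k ∈ S}`. [cite: BachLiebSolovej1994, eq. (2c.36)] -/
def planeWaveProj (S : Finset (FermionTorus d L)) :
    Matrix (FermionTorus d L) (FermionTorus d L) ℂ :=
  conjDiag d L fun k => if k ∈ S then 1 else 0

/-- `P_S` is Hermitian. [folklore] -/
theorem conjTranspose_planeWaveProj (S : Finset (FermionTorus d L)) :
    (planeWaveProj d L S)ᴴ = planeWaveProj d L S := by
  rw [planeWaveProj, conjTranspose_conjDiag]
  congr 1
  funext k
  simp only [Pi.star_apply]
  split_ifs <;> simp

/-- `P_S² = P_S`. [folklore] -/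
theorem planeWaveProj_mul_self (S : Finset (FermionTorus d L)) :
    planeWaveProj d L S * planeWaveProj d L S = planeWaveProj d L S := by
  rw [planeWaveProj, conjDiag_mul]
  congr 1
  funext k
  simp only [Pi.mul_apply]
  split_ifs <;> simp

omit [NeZero L] in
/-- The indicator sum `Σ_k [k ∈ S] = |S|`. [folklore] -/
theorem sum_indicator_eq_card (S : Finset (FermionTorus d L)) :
    ∑ k : FermionTorus d L, (if k ∈ S then (1 : ℂ) else 0) = S.card := by
  rw [Finset.sum_ite_mem, Finset.univ_inter, Finset.sum_const, nsmul_eq_mul, mul_one]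

/-- `tr P_S = |S|`. [folklore] -/
theorem trace_planeWaveProj (S : Finset (FermionTorus d L)) :
    (planeWaveProj d L S).trace = S.card := by
  rw [planeWaveProj, trace_conjDiag, sum_indicator_eq_card]

/-- **Uniform density**: `P_S(x,x) = |S| / L^d` for every site `x`. [folklore] -/
theorem planeWaveProj_apply_self (S : Finset (FermionTorus d L)) (x : FermionTorus d L) :
    planeWaveProj d L S x x = ((L : ℂ) ^ d)⁻¹ * S.card := by
  rw [planeWaveProj, conjDiag_apply_self, sum_indicator_eq_card]

/-- **Kinetic energy of the plane-wave state**: `tr (K_t P_S) = Σ_{k∈S} ε_k(t)`,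
`ε_k(t) = 2tΣᵢcos(2πkᵢ/L)` the band of `hopMatrix _ t` (`L ≥ 3`). [folklore] -/
theorem trace_hopMatrix_mul_planeWaveProj (hL : 3 ≤ L) (t : ℝ) (S : Finset (FermionTorus d L)) :
    (hopMatrix (fermionTorusGraph d L) t * planeWaveProj d L S).trace =
      ∑ k ∈ S, ((siteBand t k : ℝ) : ℂ) := by
  rw [hopMatrix_eq_conjDiag hL, planeWaveProj, conjDiag_mul, trace_conjDiag]
  simp only [Pi.mul_apply, mul_ite, mul_one, mul_zero]
  rw [Finset.sum_ite_mem, Finset.univ_inter]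

/-! ### The free (paramagnetic) Slater state and its Hartree–Fock energy -/

variable (d L) in
/-- The one-particle density matrix of the free-fermion Slater determinant filling the plane
waves `k ∈ S σ` with spin `σ`. [cite: BachLiebSolovej1994, eq. (2c.36)] -/
def freeState (S : Fin 2 → Finset (FermionTorus d L)) :
    Matrix (Orb (FermionTorus d L)) (Orb (FermionTorus d L)) ℂ :=
  spinBlock fun σ => planeWaveProj d L (S σ)

/-- The free state is Hermitian. [folklore] -/
theorem isHermitian_freeState (S : Fin 2 → Finset (FermionTorus d L)) :
    (freeState d L S).IsHermitian := by
  rw [Matrix.IsHermitian, freeState, conjTranspose_spinBlock]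
  congr 1
  funext σ
  exact conjTranspose_planeWaveProj _

/-- The free state is a projection. [folklore] -/
theorem freeState_mul_self (S : Fin 2 → Finset (FermionTorus d L)) :
    freeState d L S * freeState d L S = freeState d L S := by
  rw [freeState, spinBlock_mul_spinBlock]
  congr 1
  funext σ
  exact planeWaveProj_mul_self _

/-- The free state has `|S↑| + |S↓|` particles. [folklore] -/
theorem trace_freeState (S : Fin 2 → Finset (FermionTorus d L)) :
    (freeState d L S).trace = (((S 0).card + (S 1).card : ℕ) : ℂ) := by
  rw [freeState, trace_spinBlock, Fin.sum_univ_two, trace_planeWaveProj, trace_planeWaveProj]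
  push_cast
  rfl

/-- **Hartree–Fock energy of the free state**:
`E_HF = Σ_{k∈S↑} ε_k(-t) + Σ_{k∈S↓} ε_k(-t) + U |S↑| |S↓| / L^d`. [cite: BachLiebSolovej1994, eq. (2c.8)] -/
theorem hfEnergy_freeState (hL : 3 ≤ L) (t U : ℝ) (S : Fin 2 → Finset (FermionTorus d L)) :
    hfEnergy (fermionTorusGraph d L) t U (freeState d L S) =
      (((∑ k ∈ S 0, siteBand (-t) k) + (∑ k ∈ S 1, siteBand (-t) k) +
          U * ((S 0).card * (S 1).card) / (L : ℝ) ^ d : ℝ) : ℂ) := by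
  have hLd : ((L : ℂ) ^ d) ≠ 0 := pow_ne_zero _ (Nat.cast_ne_zero.mpr (NeZero.ne L))
  rw [freeState, hfEnergy_spinBlock, Fin.sum_univ_two, trace_hopMatrix_mul_planeWaveProj hL,
    trace_hopMatrix_mul_planeWaveProj hL]
  simp only [planeWaveProj_apply_self, Finset.sum_const, Finset.card_univ, card_fermionTorus_eq,
    nsmul_eq_mul]
  push_cast
  field_simp

/-- **Free-fermion (paramagnetic Hartree–Fock) upper bound on the torus, any filling.** For
`L ≥ 3`, all real `t, U`, all `d` and all momentum sets `S↑ S↓ ⊆ (ℤ/Lℤ)^d`: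
`E_L(|S↑| + |S↓|) ≤ Σ_{k∈S↑} ε_k + Σ_{k∈S↓} ε_k + U |S↑| |S↓| / L^d`, `ε_k = -2tΣᵢcos(2πkᵢ/L)`
(`= siteBand (-t) k`) — the energy of the plane-wave Slater determinant, by the Hartree–Fock
variational bound of Bach–Lieb–Solovej (2c.36). [cite: BachLiebSolovej1994, eq. (2c.36)] -/
theorem hubbardTorus_groundEnergyAt_le_freeFermion (hL : 3 ≤ L) (t U : ℝ)
    (Sup Sdn : Finset (FermionTorus d L)) :
    groundEnergyAt (fermionTorusGraph d L) t U (Sup.card + Sdn.card) ≤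
      (∑ k ∈ Sup, siteBand (-t) k) + (∑ k ∈ Sdn, siteBand (-t) k) +
        U * (Sup.card * Sdn.card) / (L : ℝ) ^ d := by
  set S : Fin 2 → Finset (FermionTorus d L) := fun σ => if σ = 0 then Sup else Sdn with hS
  have h0 : S 0 = Sup := rfl
  have h1 : S 1 = Sdn := rfl
  have h := groundEnergyAt_le_hfEnergy (fermionTorusGraph d L) t U
    (isHermitian_freeState S) (freeState_mul_self S) (trace_freeState S)
  rw [hfEnergy_freeState hL t U S, Complex.ofReal_re, h0, h1] at h
  exact h

/-- `ε_k` in the momentum variable. [folklore] -/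
theorem siteBand_neg_ofTorusSite (t : ℝ) (z : TorusSite d L) :
    siteBand (-t) (FermionTorus.ofTorusSite z) = -(t * (2 * ∑ i, Real.cos (latticeMomentum L z i))) := by
  simp only [siteBand, FermionTorus.toTorusSite_ofTorusSite, neg_mul]

/-- **Free-fermion upper bound, momentum form**: for `L ≥ 3`, all real `t, U` and all
`S↑ S↓ ⊆ (ℤ/Lℤ)^d`,
`E_L(|S↑| + |S↓|) ≤ -Σ_{k∈S↑} 2tΣᵢcos(2πkᵢ/L) - Σ_{k∈S↓} 2tΣᵢcos(2πkᵢ/L) + U |S↑| |S↓| / L^d`.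
[cite: BachLiebSolovej1994, eq. (2c.36)] -/
theorem hubbardTorus_groundEnergyAt_le_freeFermion_momentum (hL : 3 ≤ L) (t U : ℝ)
    (Sup Sdn : Finset (TorusSite d L)) :
    groundEnergyAt (fermionTorusGraph d L) t U (Sup.card + Sdn.card) ≤
      -(∑ k ∈ Sup, t * (2 * ∑ i, Real.cos (latticeMomentum L k i))) -
        (∑ k ∈ Sdn, t * (2 * ∑ i, Real.cos (latticeMomentum L k i))) +
        U * (Sup.card * Sdn.card) / (L : ℝ) ^ d := by
  set e : TorusSite d L ↪ FermionTorus d L := FermionTorus.equivTorusSite.symm.toEmbedding with he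
  have h := hubbardTorus_groundEnergyAt_le_freeFermion (d := d) hL t U (Sup.map e) (Sdn.map e)
  rw [Finset.card_map, Finset.card_map, Finset.sum_map, Finset.sum_map] at h
  have he' : ∀ z : TorusSite d L, e z = FermionTorus.ofTorusSite z := fun z => rfl
  simp only [he', siteBand_neg_ofTorusSite, Finset.sum_neg_distrib] at h
  linarith [h]

end HartreeFock

end Literature.MathematicalPhysics.QuantumLattice
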